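import Summits.AnomalousDissipation.AnomalousDissipation.Theorems.SolenoidalFractalHomogenisationRealisedQuasiStaticCellLawUpperSomeSectorSlot
import Mathlib.Analysis.Calculus.MeanValue
import HarnessLib

/-!
# K2R `RealisedQuasiStaticCellLaw`, line `floquet-bloch`, stub `stub_upperSome`: drift of the slow vector over one slot

Summits-side helper file (everything proved; no definitions, no named facts; `--supports stmt-AnomalousDissipation-20446`).
* `slow_drift_window` — for the three-term ladder on a window with `|g| ≤ g_T` and fast energy `Σ_{J≠0}‖v_J‖² ≤ Z` on the
  window, the heat-renormalised slow entry moves little: `‖e^{Λd₀(t−t₀)}v₀(t) − v₀(t₀)‖ ≤ e^{Λd₀(t₁−t₀)}Λ g_T γ √Z (t − t₀)`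
  (its derivative is the exchange term `−gΛ(s₋₁v₋₁ − s₀v₁)`; mean value inequality);
* `sector_slot_drift` — on the cell Galerkin truncation, slot `[a, b]` of period `p`, with `D₀ = κ4π²|ℓ|²` (the heat rate of
  the principal pair, the same in every slot) and `Z` a bound for the fast energy of the principal coset on the slot
  (`sector_slot_cone`): `‖e^{D₀(t−a)}α_N(t)(ℓ) − α_N(a)(ℓ)‖ ≤ e^{D₀τ_j}Λ_j|g₁|(√2 + γ)√Z·(t − a)` for `t ∈ [a, b]` — the
  direction of the slow vector drifts by `O(x_j)` per slot, which is what lets the isotropy of the word act on the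
  polarisation weights of a whole period.
Energy LOWER-bound half of the K2R bracket; not anomalous dissipation.
-/

set_option linter.dupNamespace false -- layout D-0017: `AnomalousDissipation.AnomalousDissipation` repeats by design

noncomputable section

namespace Summit.AnomalousDissipation.AnomalousDissipation.Theorems.SolenoidalFractalHomogenisation.RealisedQuasiStaticCellLaw

open Set MeasureTheory Filter Topology Function Complex Matrix
open scoped InnerProductSpace ComplexConjugate Matrix BigOperators
open Literature.Analysis Literature.Analysis.FunctionSpaces Literature.Analysis.FunctionSpaces.Torus
open Literature.Analysis.FluidPDE Literature.Analysis.FluidPDE.LatticeShear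
open Summit.AnomalousDissipation.AnomalousDissipation.Theorems.SolenoidalFractalHomogenisation.PermissibleCarrier

variable {k₀ : ℕ}

/-! ## §1 The abstract drift bound -/

/-- **Drift of the heat-renormalised slow entry of a three-term ladder.** On a window `[t₀, t₁]` (`W ∋ ±1`,
`γ² = s₀² + s₋₁²`, `|g| ≤ g_T`, `Λ > 0`) along which the fast energy is bounded, `Σ_{J∈W∖0}‖v_J(t)‖² ≤ Z`:
`‖exp(Λd₀(t−t₀))·v₀(t) − v₀(t₀)‖ ≤ exp(Λd₀(t₁−t₀))·Λ g_T γ √Z·(t − t₀)` for `t ∈ [t₀, t₁]` (`d₀ ≥ 0`). -/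
theorem slow_drift_window (W : Finset ℤ) (h1 : (1 : ℤ) ∈ W) (hm1 : (-1 : ℤ) ∈ W)
    (d s : ℤ → ℝ) (Λ gT γ Z t₀ t₁ : ℝ) (g : ℝ → ℝ) (v : ℝ → ℤ → ℂ)
    (hγ : γ ^ 2 = s 0 ^ 2 + s (-1) ^ 2) (hγ0 : 0 ≤ γ) (hd0 : 0 ≤ d 0) (hΛ : 0 < Λ)
    (hgT : ∀ t ∈ Icc t₀ t₁, |g t| ≤ gT) (hgT0 : 0 ≤ gT)
    (hZ : ∀ t ∈ Icc t₀ t₁, ∑ J ∈ W.erase 0, ‖v t J‖ ^ 2 ≤ Z)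
    (hderiv0 : ∀ t ∈ Icc t₀ t₁, HasDerivWithinAt (fun τ => v τ 0)
        (-(Λ : ℂ) * ((d 0 : ℂ) * v t 0) -
          (g t : ℂ) * (Λ : ℂ) * ((s (0 - 1) : ℂ) * v t (0 - 1) - (s 0 : ℂ) * v t (0 + 1))) (Icc t₀ t₁) t) :
    ∀ t ∈ Icc t₀ t₁, ‖((Real.exp (Λ * d 0 * (t - t₀)) : ℝ) : ℂ) * v t 0 - v t₀ 0‖ ≤
      Real.exp (Λ * d 0 * (t₁ - t₀)) * (Λ * gT * γ * Real.sqrt Z) * (t - t₀) := by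
  classical
  have h1W' : (1 : ℤ) ∈ W.erase 0 := Finset.mem_erase.2 ⟨by norm_num, h1⟩
  have hm1W' : (-1 : ℤ) ∈ W.erase 0 := Finset.mem_erase.2 ⟨by norm_num, hm1⟩
  set f : ℝ → ℂ := fun τ => ((Real.exp (Λ * d 0 * (τ - t₀)) : ℝ) : ℂ) * v τ 0 with hf
  set f' : ℝ → ℂ := fun τ => ((Real.exp (Λ * d 0 * (τ - t₀)) : ℝ) : ℂ) *
    (-((g τ : ℂ) * (Λ : ℂ) * ((s (0 - 1) : ℂ) * v τ (0 - 1) - (s 0 : ℂ) * v τ (0 + 1)))) with hf'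
  -- the derivative of `f`
  have hfd : ∀ τ ∈ Icc t₀ t₁, HasDerivWithinAt f (f' τ) (Icc t₀ t₁) τ := by
    intro τ hτ
    have he : HasDerivWithinAt (fun τ' => ((Real.exp (Λ * d 0 * (τ' - t₀)) : ℝ) : ℂ))
        (((Real.exp (Λ * d 0 * (τ - t₀)) * (Λ * d 0) : ℝ) : ℂ)) (Icc t₀ t₁) τ := by
      have h1 : HasDerivWithinAt (fun τ' => Λ * d 0 * (τ' - t₀)) (Λ * d 0) (Icc t₀ t₁) τ := by
        simpa using ((hasDerivWithinAt_id τ (Icc t₀ t₁)).sub_const t₀).const_mul (Λ * d 0)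
      exact (h1.exp).ofReal_comp
    have h := he.mul (hderiv0 τ hτ)
    refine h.congr_deriv ?_
    simp only [hf']
    push_cast
    ring
  -- the bound on the derivative
  have hbound : ∀ τ ∈ Icc t₀ t₁, ‖f' τ‖ ≤ Real.exp (Λ * d 0 * (t₁ - t₀)) * (Λ * gT * γ * Real.sqrt Z) := by
    intro τ hτ
    simp only [hf']
    rw [norm_mul, Complex.norm_real, Real.norm_eq_abs, abs_of_pos (Real.exp_pos _), norm_neg, norm_mul, norm_mul,
      Complex.norm_real, Complex.norm_real, Real.norm_eq_abs, Real.norm_eq_abs, abs_of_pos hΛ]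
    have hexp : Real.exp (Λ * d 0 * (τ - t₀)) ≤ Real.exp (Λ * d 0 * (t₁ - t₀)) :=
      Real.exp_le_exp.2 (mul_le_mul_of_nonneg_left (by linarith [hτ.2]) (mul_nonneg hΛ.le hd0))
    have hlink : ‖(s (0 - 1) : ℂ) * v τ (0 - 1) - (s 0 : ℂ) * v τ (0 + 1)‖ ≤ γ * Real.sqrt Z := by
      have h := norm_sub_two_le_sqrt (s (0 - 1)) (s 0) (v τ (0 - 1)) (v τ (0 + 1))
      have eγ : Real.sqrt (s (0 - 1) ^ 2 + s 0 ^ 2) = γ := by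
        rw [show (0:ℤ) - 1 = -1 by norm_num, add_comm, ← hγ, Real.sqrt_sq hγ0]
      rw [eγ] at h
      refine h.trans (mul_le_mul_of_nonneg_left (Real.sqrt_le_sqrt ?_) hγ0)
      have hsub : ({-1, 1} : Finset ℤ) ⊆ W.erase 0 := by
        intro J hJ
        simp only [Finset.mem_insert, Finset.mem_singleton] at hJ
        rcases hJ with rfl | rfl
        · exact hm1W'
        · exact h1W'
      have h2 := Finset.sum_le_sum_of_subset_of_nonneg hsub (fun J _ _ => sq_nonneg ‖v τ J‖)
      rw [Finset.sum_pair (by norm_num)] at h2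
      simp only [show (0:ℤ) - 1 = -1 by norm_num, zero_add]
      exact h2.trans (hZ τ hτ)
    calc Real.exp (Λ * d 0 * (τ - t₀)) * (|g τ| * Λ * ‖(s (0 - 1) : ℂ) * v τ (0 - 1) - (s 0 : ℂ) * v τ (0 + 1)‖)
        ≤ Real.exp (Λ * d 0 * (t₁ - t₀)) * (gT * Λ * (γ * Real.sqrt Z)) := by
          refine mul_le_mul hexp ?_ (by positivity) (Real.exp_pos _).le
          exact mul_le_mul (mul_le_mul_of_nonneg_right (hgT τ hτ) hΛ.le) hlink (norm_nonneg _) (by positivity)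
      _ = Real.exp (Λ * d 0 * (t₁ - t₀)) * (Λ * gT * γ * Real.sqrt Z) := by ring
  intro t ht
  have ht₀ : t₀ ∈ Icc t₀ t₁ := ⟨le_rfl, ht.1.trans ht.2⟩
  have h := Convex.norm_image_sub_le_of_norm_hasDerivWithin_le hfd hbound (convex_Icc t₀ t₁) ht₀ ht
  have hf0 : f t₀ = v t₀ 0 := by simp [hf]
  rw [hf0] at h
  simp only [hf] at h
  rw [Real.norm_eq_abs, abs_of_nonneg (by linarith [ht.1])] at h
  exact h

/-! ## §2 The cell problem: drift of the slow vector over one slot -/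

/-- `√(a² + b²) ≤ |a| + |b|` (private copy of a folklore one-liner). -/
private theorem sqrt_sq_add_sq_le (x y : ℝ) : Real.sqrt (x ^ 2 + y ^ 2) ≤ |x| + |y| := by
  rw [← Real.sqrt_sq (add_nonneg (abs_nonneg x) (abs_nonneg y))]
  refine Real.sqrt_le_sqrt ?_
  nlinarith [abs_nonneg x, abs_nonneg y, sq_abs x, sq_abs y]

set_option maxHeartbeats 400000 in -- two ladder packages instantiated in one statement
/-- **Drift of the slow vector of the sector truncation over one slot.** In the setting of `sector_slot_cone` (principal
coset of `ℓ`, frame `(ζ, p_J)`, segment `Wset ∋ 0, ±1`, `Λ = κ4π²|K_j|²`, peak coupling `g₁`, in-plane `γ`), if the fast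
energy of the principal coset is at most `Z` along the slot `[a, b]`, then with the heat rate `D₀ = κ4π²|ℓ|²` of the
principal pair, `‖e^{D₀(t−a)}α_N(t)(ℓ) − α_N(a)(ℓ)‖ ≤ e^{D₀τ_j}·Λ|g₁|(√2 + γ)√Z·(t − a)` for every `t ∈ [a, b]`. -/
theorem sector_slot_drift (W : LatticeWord k₀) {n : ℕ} (hn : 0 < n) {κ : ℝ} (hκ : 0 < κ)
    (ℓ : Fin 3 → ℤ) {w₀ : UnitAddTorus (Fin 3) → EuclideanSpace ℝ (Fin 3)}
    (hw₀ : FunctionSpaces.Torus.MemSobolev 1 (FunctionSpaces.EuclideanSpace.complexify ∘ w₀))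
    (hdiv : FunctionSpaces.Torus.IsWeaklyDivFree w₀) (hmean : FunctionSpaces.Torus.HasZeroMean w₀)
    (hsupp : ∀ k : Fin 3 → ℤ, ¬ ((∃ z : Fin 3 → ℤ, k = ℓ + (n:ℤ) • z) ∨ (∃ z : Fin 3 → ℤ, k = -ℓ + (n:ℤ) • z)) →
      UnitAddTorus.mFourierCoeff (FunctionSpaces.EuclideanSpace.complexify ∘ w₀) k = 0)
    {N : ℕ} (hBN : (Finset.univ.biUnion fun j : Fin k₀ =>
        ({(fun i => (W.phase j).m i * n), -(fun i => (W.phase j).m i * n)} : Finset (Fin 3 → ℤ))) ⊆ freqBall N)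
    {T : ℝ} (p : ℕ) (j : Fin k₀) (hT : (p : ℝ) * W.period + W.start j + (W.phase j).τ ≤ T)
    (hk : ∀ J : ℤ, ℓ + J • (fun i => (W.phase j).m i * (n : ℤ)) ∈ freqBall N → ℓ + J • (fun i => (W.phase j).m i * (n : ℤ)) ≠ 0)
    {ζr : Fin 3 → ℝ} (hζ1 : ζr ⬝ᵥ ζr = 1) (hζ0 : ζr ⬝ᵥ (fun i => ((ℓ i : ℤ) : ℝ)) = 0)
    (hζK : ζr ⬝ᵥ (fun i => (((fun i => (W.phase j).m i * (n : ℤ)) i : ℤ) : ℝ)) = 0)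
    {pf : ℤ → Fin 3 → ℝ}
    (hp : ∀ J : ℤ, pf J = (Real.sqrt ((fun i => (((ℓ + J • (fun i => (W.phase j).m i * (n : ℤ))) i : ℤ) : ℝ)) ⬝ᵥ
        (fun i => (((ℓ + J • (fun i => (W.phase j).m i * (n : ℤ))) i : ℤ) : ℝ))))⁻¹ • (fun i => (((ℓ + J • (fun i => (W.phase j).m i * (n : ℤ))) i : ℤ) : ℝ)) ⨯₃ ζr)
    {Wset : Finset ℤ} (hW : ∀ J : ℤ, J ∈ Wset ↔ ℓ + J • (fun i => (W.phase j).m i * (n : ℤ)) ∈ freqBall N)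
    (h0 : (0 : ℤ) ∈ Wset) (h1 : (1 : ℤ) ∈ Wset) (hm1 : (-1 : ℤ) ∈ Wset)
    (Λ g₁ γ Z : ℝ) (hΛ : Λ = κ * (4 * Real.pi ^ 2 * freqNormSq (fun i => (W.phase j).m i * (n : ℤ))))
    (hγ : γ ^ 2 = (pf 0 ⬝ᵥ pf 1) ^ 2 + (pf (-1) ⬝ᵥ pf 0) ^ 2) (hγ0 : 0 ≤ γ)
    (hg₁ : g₁ = 2 * Real.pi * (∑ i, (W.phase j).e i * (ℓ i : ℝ)) *
        ‖Complex.exp ((W.phase j).φ * Complex.I) *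
          (1 / (2 * ((2 * Real.pi * ‖latticeVec (W.phase j).m‖ : ℝ) : ℂ) * Complex.I))‖ * (1 / (n : ℝ)) / Λ)
    (hZ : ∀ t ∈ Icc ((p : ℝ) * W.period + W.start j) ((p : ℝ) * W.period + W.start j + (W.phase j).τ),
      ∑ J ∈ Wset.erase 0, (‖inner ℂ (WithLp.toLp 2 (Complex.ofReal ∘ ζr) : EuclideanSpace ℂ (Fin 3)) ((pvSetup_cell W hn hκ.le ℓ hw₀ hdiv hmean hsupp).galerkinCoeffAt N t (ℓ + J • (fun i => (W.phase j).m i * (n : ℤ))))‖ ^ 2 +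
          ‖inner ℂ (WithLp.toLp 2 (Complex.ofReal ∘ pf J) : EuclideanSpace ℂ (Fin 3)) ((pvSetup_cell W hn hκ.le ℓ hw₀ hdiv hmean hsupp).galerkinCoeffAt N t (ℓ + J • (fun i => (W.phase j).m i * (n : ℤ))))‖ ^ 2) ≤ Z) :
    ∀ t ∈ Icc ((p : ℝ) * W.period + W.start j) ((p : ℝ) * W.period + W.start j + (W.phase j).τ),
      ‖((Real.exp (κ * (4 * Real.pi ^ 2 * freqNormSq ℓ) * (t - ((p : ℝ) * W.period + W.start j))) : ℝ) : ℂ) • (pvSetup_cell W hn hκ.le ℓ hw₀ hdiv hmean hsupp).galerkinCoeffAt N t ℓ - (pvSetup_cell W hn hκ.le ℓ hw₀ hdiv hmean hsupp).galerkinCoeffAt N ((p : ℝ) * W.period + W.start j) ℓ‖ ≤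
        Real.exp (κ * (4 * Real.pi ^ 2 * freqNormSq ℓ) * (W.phase j).τ) * (Λ * |g₁| * (Real.sqrt 2 + γ) * Real.sqrt Z) *
          (t - ((p : ℝ) * W.period + W.start j)) := by
  classical
  set hPV := pvSetup_cell W hn hκ.le ℓ hw₀ hdiv hmean hsupp with hPVdef
  set K : Fin 3 → ℤ := (fun i => (W.phase j).m i * (n : ℤ)) with hK
  set ζc : EuclideanSpace ℂ (Fin 3) := WithLp.toLp 2 (Complex.ofReal ∘ ζr) with hζc
  set pc : ℤ → EuclideanSpace ℂ (Fin 3) := fun J => WithLp.toLp 2 (Complex.ofReal ∘ pf J) with hpc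
  obtain ⟨a, ha⟩ : ∃ a : ℝ, a = (p : ℝ) * W.period + W.start j := ⟨_, rfl⟩
  set τ : ℝ := (W.phase j).τ with hτdef
  -- complex transversality of `ζ`
  have hcast : ∀ k : Fin 3 → ℤ, ζr ⬝ᵥ (fun i => ((k i : ℤ) : ℝ)) = 0 → ∑ i, ((k i : ℤ) : ℂ) * ζc i = 0 := by
    intro k hk0
    have e : ∑ i, ((k i : ℤ) : ℂ) * ζc i = (((ζr ⬝ᵥ fun i => ((k i : ℤ) : ℝ) : ℝ)) : ℂ) := by
      rw [dotProduct]; push_cast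
      refine Finset.sum_congr rfl fun i _ => ?_
      simp [hζc, mul_comm]
    rw [e, hk0]; simp
  obtain ⟨go, vo, hgo, hsuppo, hdo, hno, hvo0⟩ := outOfPlane_slot_ladder W hn hκ ℓ hw₀ hdiv hmean hsupp hBN p j hT ℓ
    (hcast ℓ hζ0) (hcast _ hζK) hW Λ g₁ hΛ hg₁
  obtain ⟨gi, vi, hgi, hsuppi, hdi, hni, hvi0⟩ := inPlane_slot_ladder W hn hκ ℓ hw₀ hdiv hmean hsupp hBN p j hT ℓ hk hζ1
    hζ0 hζK hp hW Λ g₁ hΛ hg₁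
  rw [← ha] at hgo hsuppo hdo hgi hsuppi hdi hZ ⊢
  set d : ℤ → ℝ := fun J => freqNormSq (ℓ + J • K) / freqNormSq K with hddef
  have hΛ0 : 0 < Λ := by rw [hΛ]; exact cellRate_pos (W.phase j) hn hκ
  have hKpos : 0 < freqNormSq K := by
    have hK0 : K ≠ 0 := cellFreq_ne_zero (W.phase j) hn
    obtain ⟨i, hi⟩ : ∃ i, K i ≠ 0 := by
      by_contra h
      push Not at h
      exact hK0 (funext h)
    have hi' : (K i : ℝ) ≠ 0 := by exact_mod_cast hi
    unfold freqNormSq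
    exact lt_of_lt_of_le (by positivity) (Finset.single_le_sum (fun l _ => sq_nonneg ((K l : ℝ))) (Finset.mem_univ i))
  have hD : Λ * d 0 = κ * (4 * Real.pi ^ 2 * freqNormSq ℓ) := by
    simp only [hddef, zero_smul, add_zero]
    rw [hΛ]; field_simp
  have hd0 : 0 ≤ d 0 := by simp only [hddef]; exact div_nonneg (freqNormSq_nonneg _) (freqNormSq_nonneg _)
  have hgTo : ∀ t ∈ Icc a (a + τ), |go t| ≤ |g₁| := by
    intro t ht; rw [hgo t ht]; exact abs_mul_trapezoid_le _ _ _ _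
  have hgTi : ∀ t ∈ Icc a (a + τ), |gi t| ≤ |g₁| := by
    intro t ht; rw [hgi t ht]; exact abs_mul_trapezoid_le _ _ _ _
  -- the fast energies of the two ladders are bounded by `Z`
  have hZo : ∀ t ∈ Icc a (a + τ), ∑ J ∈ Wset.erase 0, ‖vo t J‖ ^ 2 ≤ Z := by
    intro t ht
    refine le_trans ?_ (hZ t ht)
    refine Finset.sum_le_sum fun J _ => ?_
    rw [hno t J]
    exact le_add_of_nonneg_right (sq_nonneg _)
  have hZi : ∀ t ∈ Icc a (a + τ), ∑ J ∈ Wset.erase 0, ‖vi t J‖ ^ 2 ≤ Z := by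
    intro t ht
    refine le_trans ?_ (hZ t ht)
    refine Finset.sum_le_sum fun J _ => ?_
    rw [hni t J]
    exact le_add_of_nonneg_left (sq_nonneg _)
  -- the two scalar drifts
  have hγo : Real.sqrt 2 ^ 2 = (fun _ : ℤ => (1 : ℝ)) 0 ^ 2 + (fun _ : ℤ => (1 : ℝ)) (-1) ^ 2 := by
    rw [Real.sq_sqrt (by norm_num)]; norm_num
  have hγi : γ ^ 2 = (fun J : ℤ => pf J ⬝ᵥ pf (J + 1)) 0 ^ 2 + (fun J : ℤ => pf J ⬝ᵥ pf (J + 1)) (-1) ^ 2 := by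
    rw [hγ]; simp only [zero_add, neg_add_cancel]
  have hdrifto := slow_drift_window Wset h1 hm1 d (fun _ => (1 : ℝ)) Λ |g₁| (Real.sqrt 2) Z a (a + τ) go vo hγo
    (Real.sqrt_nonneg _) hd0 hΛ0 hgTo (abs_nonneg _) hZo (fun t ht => hdo t ht 0 h0)
  have hdrifti := slow_drift_window Wset h1 hm1 d (fun J : ℤ => pf J ⬝ᵥ pf (J + 1)) Λ |g₁| γ Z a (a + τ) gi vi hγi
    hγ0 hd0 hΛ0 hgTi (abs_nonneg _) hZi (fun t ht => hdi t ht 0 h0)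
  intro t ht
  set c : ℝ := Real.exp (κ * (4 * Real.pi ^ 2 * freqNormSq ℓ) * (t - a)) with hc
  set x : EuclideanSpace ℂ (Fin 3) := ((c : ℝ) : ℂ) • hPV.galerkinCoeffAt N t ℓ - hPV.galerkinCoeffAt N a ℓ with hx
  -- the two components of `x`
  have hxo : inner ℂ ζc x = ((c : ℝ) : ℂ) * vo t 0 - vo a 0 := by
    simp only [hx]
    rw [inner_sub_right, inner_smul_right, hvo0 t, hvo0 a]
  have hxi : inner ℂ (pc 0) x = ((c : ℝ) : ℂ) * vi t 0 - vi a 0 := by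
    simp only [hx, hpc]
    rw [inner_sub_right, inner_smul_right, hvi0 t, hvi0 a]
  -- `x` is transversal to `ℓ`
  have hℓ0 : ℓ ≠ 0 := by have := hk 0 ((hW 0).1 h0); simpa using this
  have hxT : (fun i => ((ℓ i : ℤ) : ℂ)) ⬝ᵥ WithLp.ofLp x = 0 := by
    have h1 := hPV.sum_mul_galerkinCoeffAt N t ℓ
    have h2 := hPV.sum_mul_galerkinCoeffAt N a ℓ
    simp only [hx, dotProduct, WithLp.ofLp_sub, WithLp.ofLp_smul, Pi.sub_apply, Pi.smul_apply, smul_eq_mul, mul_sub,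
      Finset.sum_sub_distrib]
    have e1 : ∑ i, ((ℓ i : ℤ) : ℂ) * (((c : ℝ) : ℂ) * (hPV.galerkinCoeffAt N t ℓ) i) =
        ((c : ℝ) : ℂ) * ∑ i, ((ℓ i : ℤ) : ℂ) * (hPV.galerkinCoeffAt N t ℓ) i := by
      rw [Finset.mul_sum]; refine Finset.sum_congr rfl fun i _ => ?_; ring
    rw [e1, h1, h2, mul_zero, sub_zero]
  have hsplit := norm_sq_eq_blocks_of_transversal hℓ0 hζ1 hζ0 x hxT
  have hp0 : pf 0 = (Real.sqrt ((fun i => ((ℓ i : ℤ) : ℝ)) ⬝ᵥ (fun i => ((ℓ i : ℤ) : ℝ))))⁻¹ •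
      (fun i => ((ℓ i : ℤ) : ℝ)) ⨯₃ ζr := by have := hp 0; simpa using this
  rw [← hp0] at hsplit
  change ‖x‖ ^ 2 = ‖inner ℂ ζc x‖ ^ 2 + ‖inner ℂ (pc 0) x‖ ^ 2 at hsplit
  rw [hxo, hxi] at hsplit
  have ho := hdrifto t ht
  have hi := hdrifti t ht
  rw [show a + τ - a = τ by ring, hD, ← hc] at ho hi
  -- combine
  set Bo : ℝ := Real.exp (κ * (4 * Real.pi ^ 2 * freqNormSq ℓ) * τ) * (Λ * |g₁| * Real.sqrt 2 * Real.sqrt Z) * (t - a)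
    with hBo
  set Bi : ℝ := Real.exp (κ * (4 * Real.pi ^ 2 * freqNormSq ℓ) * τ) * (Λ * |g₁| * γ * Real.sqrt Z) * (t - a) with hBi
  have hBo0 : 0 ≤ Bo := by rw [hBo]; have := ht.1; positivity
  have hBi0 : 0 ≤ Bi := by rw [hBi]; have := ht.1; positivity
  have hxsq : ‖x‖ ^ 2 ≤ Bo ^ 2 + Bi ^ 2 := by
    rw [hsplit]
    exact add_le_add (pow_le_pow_left₀ (norm_nonneg _) ho 2) (pow_le_pow_left₀ (norm_nonneg _) hi 2)
  have hxle : ‖x‖ ≤ Bo + Bi := by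
    have h := Real.sqrt_le_sqrt hxsq
    rw [Real.sqrt_sq (norm_nonneg _)] at h
    refine h.trans ((sqrt_sq_add_sq_le Bo Bi).trans ?_)
    rw [abs_of_nonneg hBo0, abs_of_nonneg hBi0]
  have e : Bo + Bi = Real.exp (κ * (4 * Real.pi ^ 2 * freqNormSq ℓ) * τ) *
      (Λ * |g₁| * (Real.sqrt 2 + γ) * Real.sqrt Z) * (t - a) := by rw [hBo, hBi]; ring
  rw [← e]
  exact hxle

end Summit.AnomalousDissipation.AnomalousDissipation.Theorems.SolenoidalFractalHomogenisation.RealisedQuasiStaticCellLaw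

end
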